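import Mathlib
import Literature.NumberTheory.Automorphic.TwistedQuotientConeDescentStep
import Literature.NumberTheory.Automorphic.ResGLnConeDictionaryCone
import Literature.NumberTheory.Automorphic.ResGLnCohomology
import Summits.Langlands.Langlands.Theorems.IrreducibilityBySelfDualityHeckeEigenvalueFieldDescentTower
import Summits.Langlands.Langlands.Theorems.IrreducibilityBySelfDualityHeckeEigenvalueFieldStubStairBottom
import HarnessLib

/-!
# Crux `HeckeEigenvalueField` (stmt-Langlands-13632), line `Sketch` — stub FAM-STAIR-ALG2: the corrected
# per-coset staircase has no degree-`0` coboundary parts, `δκ_q = 0`, `dκ_0 = ω`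

Namespace `Summit.Langlands.Langlands.Theorems.HeckeEigenvalueField.Res`; theorems only; setting of
`Literature/NumberTheory/Automorphic/TwistedQuotientConeDescent{,Rows,Step}.lean`.  For a family `ω` of
smooth closed `(q+1)`-forms placed in degree `q + 1` (`single`) and `b` whose simplicial coboundary is the
cone period cochain of `ω`, the staircase `κ_j = stair j` (`j < q`), `κ_q = stair q - E(ε_{q+1} b)`
(`ε_p = (-1)^{p(p+1)/2}`) has coboundaries without degree-`0` parts on `X`, `δκ_q = 0` in every degree and
`dκ_0 = ω` in degree `q + 1` (`FamStairAlg.main2`: concentration, TOWER-CONST `stub_delta_stair_const`,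
BOTTOM `stub_delta_stair_bottom`, `cochD_stair_zero`).  The registered stub `stub_fam_stair_alg2` is the
instance `Γ = 𝒢 = Γc ≤ GL_n(K)⁺` fixing the level coset `cL` (`L = ⊤`), `ω = coneForm η cL.out`.
[cite: BottTu1982Forms, §I.4 and §II.9] [cite: Dupont1976, §1–2]
-/

set_option linter.dupNamespace false -- project-wide: `Summit.Langlands.Langlands` is the mandated namespace

noncomputable section

open scoped Matrix.Norms.Operator Topology
open Filter

attribute [-instance] instTopologicalSpaceMatrix
attribute [-instance] Matrix.instUniformSpace
attribute [local instance high] NormedAddCommGroup.toSeminormedAddCommGroup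

open scoped Classical Matrix TensorProduct ContDiff
open Set NumberField NumberField.mixedEmbedding Literature.Analysis.Calculus Literature.Geometry.Kaehler
open Literature.NumberTheory.Automorphic Literature.NumberTheory.Automorphic.TwistedQuotient

namespace Summit.Langlands.Langlands.Theorems.HeckeEigenvalueField.Res

open ResGLnCohomology BigHeckeGLn

namespace FamStairAlg

variable {Γ 𝒢 : Type} [Group Γ] [Group 𝒢] (ι : Γ →* 𝒢) (L : Subgroup 𝒢)
  {V : Type} [NormedAddCommGroup V] [NormedSpace ℂ V]
  (ρ : Representation ℂ Γ V)
  {W : Type} [NormedAddCommGroup W] [NormedSpace ℝ W]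
  (a : Γ →* (W →L[ℝ] W)) {X : Set W} {x₀ : W}

/-- **FAM-STAIR-ALG2, generic form**: for `ω` smooth and closed on the open convex `Γ`-stable `X ∋ x₀` and
`conePeriod (ω_c) [a(g₀)x₀, …, a(g_{q+1})x₀] = ∑ᵢ (-1)ⁱ b(g ∘ σᵢ)`, the coboundaries of `κ` have no
degree-`0` parts on `X` (concentration `stair_apply_eq_zero`; for `j = q`: TOWER-CONST + BOTTOM + the
periods), `δκ_q = 0`, and `dκ_0 = ω` (`cochD_stair_zero`). [cite: BottTu1982Forms, §I.4 and §II.9] -/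
theorem main2 [CompleteSpace V] [FiniteDimensional ℝ W]
    (hXo : IsOpen X) (hXc : Convex ℝ X) (hmaps : ∀ γ : Γ, MapsTo (a γ) X X) (hx₀ : x₀ ∈ X)
    {q : ℕ} (om : 𝒢 → W → W [⋀^Fin (q + 1)]→L[ℝ] V) (hωs : ∀ c, ContDiffOn ℝ ∞ (om c) X)
    (hωd : ∀ c : 𝒢 ⧸ L, ∀ x ∈ X, extDeriv (om c.out) x = 0)
    (b : (Fin (q + 1) → Γ) → V)
    (hbδ : ∀ (g : Fin (q + 2) → Γ) (c : 𝒢 ⧸ L),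
      conePeriod (q + 1) (om c.out) (fun i => a (g i) x₀) =
        ∑ i : Fin (q + 2), ((-1 : ℂ) ^ (i : ℕ)) • b fun j => g (i.succAbove j))
    (κ : (j : ℕ) → Coch Γ L W V j)
    (hκlt : ∀ j, j < q → κ j = stair L a (TwistedQuotient.single L fun c => om c.out) x₀ j)
    (hκq0 : ∀ (g : Fin (q + 1) → Γ) (c : 𝒢 ⧸ L) (x : W), κ q g c 0 x =
      stair L a (TwistedQuotient.single L fun c => om c.out) x₀ q g c 0 x -
        ContinuousAlternatingMap.constOfIsEmpty ℝ W (Fin 0)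
          ((((-1 : ℝ) ^ ((q + 1) * (q + 2) / 2)) : ℂ) • b g))
    (hκqs : ∀ (g : Fin (q + 1) → Γ) (c : 𝒢 ⧸ L) (r : ℕ) (x : W), κ q g c (r + 1) x =
      stair L a (TwistedQuotient.single L fun c => om c.out) x₀ q g c (r + 1) x) :
    (∀ j ≤ q, ∀ (g : Fin (j + 2) → Γ) (c : 𝒢 ⧸ L), ∀ x ∈ X, delta L (κ j) g c 0 x = 0) ∧
    (∀ (g : Fin (q + 2) → Γ) (c : 𝒢 ⧸ L) (r : ℕ), ∀ x ∈ X, delta L (κ q) g c r x = 0) ∧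
    ∀ (g : Fin 1 → Γ) (c : 𝒢 ⧸ L), ∀ x ∈ X, cochD L (κ 0) g c (q + 1) x = om c.out x := by
  have hom_s : ∀ (c : 𝒢 ⧸ L) (r : ℕ), ContDiffOn ℝ ∞ (TwistedQuotient.single L (fun c => om c.out) c r) X := by
    intro c r
    by_cases h : r = q + 1
    · subst h; rw [single_self]; exact hωs c.out
    · rw [single_of_ne L _ c h]; exact contDiffOn_const
  have hom_d : ∀ (c : 𝒢 ⧸ L) (r : ℕ), ∀ x ∈ X,
      extDeriv (TwistedQuotient.single L (fun c => om c.out) c r) x = 0 := by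
    intro c r x hx
    by_cases h : r = q + 1
    · subst h; rw [single_self]; exact hωd c x hx
    · rw [single_of_ne L _ c h]
      simp only [extDeriv, fderiv_zero, Pi.zero_apply]
      exact map_zero (ContinuousAlternatingMap.alternatizeUncurryFinCLM ℝ W V)
  have hom_0 := fun (c : 𝒢 ⧸ L) (r : ℕ) (hr : r ≠ q + 1) => single_of_ne L (fun c => om c.out) c hr
  -- real versus complex scalars on `V`
  have hrc : ∀ (t : ℝ) (v : V), t • v = (t : ℂ) • v := fun t v => rfl
  have hsm := smoothOn_stair L a hXo hXc hmaps hx₀ _ hom_s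
  have hvan := stair_apply_eq_zero L a (x₀ := x₀) _ hom_0
  -- the degree-`0` part of `δκ_q` vanishes on `X`: TOWER-CONST + BOTTOM + periods
  have h4top : ∀ (g : Fin (q + 2) → Γ) (c : 𝒢 ⧸ L), ∀ x ∈ X, delta L (κ q) g c 0 x = 0 := by
    intro g c x hx
    have hstair : ∀ p ≤ q, ∀ (g' : Fin (p + 1) → Γ) (c' : 𝒢 ⧸ L) (r : ℕ),
        ContinuousOn (stair L a (TwistedQuotient.single L fun c'' => om c''.out) x₀ p g' c' r) X :=
      fun p _ g' c' r => (hsm p g' c' r).continuousOn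
    have hsplit : delta L (κ q) g c 0 x =
        delta L (stair L a (TwistedQuotient.single L fun c => om c.out) x₀ q) g c 0 x -
          ContinuousAlternatingMap.constOfIsEmpty ℝ W (Fin 0)
            (∑ i : Fin (q + 2), ((-1 : ℝ) ^ (i : ℕ)) •
              ((((-1 : ℝ) ^ ((q + 1) * (q + 2) / 2)) : ℂ) • b fun j => g (i.succAbove j))) := by
      rw [delta_apply, delta_apply]
      simp only [Finset.sum_apply, Pi.smul_apply, hκq0, smul_sub, Finset.sum_sub_distrib]
      congr 1
      ext v
      simp only [ContinuousAlternatingMap.sum_apply, ContinuousAlternatingMap.smul_apply,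
        ContinuousAlternatingMap.constOfIsEmpty_apply]
    rw [hsplit, stub_delta_stair_const L a hXo hXc hmaps hx₀ _ hom_s hom_d q g c hx,
      stub_delta_stair_bottom L a hXo hXc (fun γ => hmaps γ hx₀) om hωs hstair g c,
      coneCochain_apply, sub_eq_zero]
    ext v
    simp only [ContinuousAlternatingMap.smul_apply, ContinuousAlternatingMap.constOfIsEmpty_apply]
    rw [hbδ g c, Finset.smul_sum]
    refine Finset.sum_congr rfl fun i _ => ?_
    rw [hrc, hrc, smul_smul, smul_smul]
    congr 1
    push_cast
    ring
  refine ⟨?_, ?_, ?_⟩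
  · -- degree-`0` parts
    intro j hj
    rcases hj.lt_or_eq with hlt | rfl
    · intro g c x hx
      rw [hκlt j hlt, delta_apply]
      simp only [Finset.sum_apply, Pi.smul_apply]
      exact Finset.sum_eq_zero fun i _ => by rw [hvan j _ c 0 (by omega), Pi.zero_apply, smul_zero]
    · exact h4top
  · -- `δκ_q = 0` on `X` in every degree
    intro g c r x hx
    cases r with
    | zero => exact h4top g c x hx
    | succ r =>
      rw [delta_apply]
      simp only [Finset.sum_apply, Pi.smul_apply, hκqs]
      exact Finset.sum_eq_zero fun i _ => by rw [hvan q _ c (r + 1) (by omega), Pi.zero_apply, smul_zero]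
  · -- `dκ_0 = ω` on `X` in degree `q + 1`
    intro g c x hx
    have key := cochD_stair_zero L a hXo hXc hmaps hx₀ _ hom_s hom_d g c q hx
    rw [single_self] at key
    rcases Nat.eq_zero_or_pos q with hq | hq
    · subst hq
      rw [cochD_apply, famD_succ] at key ⊢; rw [show κ 0 g c 0 = fun y =>
          stair L a (TwistedQuotient.single L fun c => om c.out) x₀ 0 g c 0 y -
            ContinuousAlternatingMap.constOfIsEmpty ℝ W (Fin 0)
              ((((-1 : ℝ) ^ ((0 + 1) * (0 + 2) / 2)) : ℂ) • b g) from funext (hκq0 g c)]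
      simp only [extDeriv, fderiv_sub_const] at key ⊢
      exact key
    · rw [hκlt 0 hq]; exact key

end FamStairAlg

/-- **Stub FAM-STAIR-ALG2 — the per-coset staircase: no degree-`0` coboundary parts, `δκ_q = 0`, `dκ₀ = ω_c`.**
Same `κ` as FAM-STAIR-ALG1: the degree-`0` parts of `δκ_j` vanish (`stair j` lives in form-degree `q - j`;
for `j = q`: BOTTOM at the last vertex + TOWER-CONST + `δb = ` cone periods), `δκ_q = 0` in every degree,
and `dκ₀ = ω_c` in degree `q+1` (`dK + Kd = 1`, `dω = 0`).  Landed TOWER p150433, BOTTOM p150811.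
[cite: BottTu1982Forms, §I.4 and §II.9] [cite: Dupont1976, §1–2] -/
theorem stub_fam_stair_alg2 {n : ℕ} {K : Type} [Field K] [NumberField K]
    (hcpt : isCompact_glFiniteIntegralLevel n K) (𝔫 : Ideal (𝓞 K))
    (π : CuspidalAutomorphicRepData n K hcpt)
    (S : Finset {w : InfinitePlace K // w.IsReal}) (lam : (K →+* ℂ) → Fin n → ℤ) {q : ℕ}
    {η : ConeDictionary.Cochain π.1 lam (q + 1)}
    (hω : TwistedQuotient.IsConeFormFamily (diagPos n K) (level n K 𝔫) (coeffRepPos ℂ n K lam)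
      ((ResGLnCone.coneActionRat n K).comp (glTotPos n K).subtype) (ResGLnCone.posCone n K)
      (fun c H => ConeDictionary.coneForm π.1 S lam η c H))
    (cL : FiniteAdelicGL n K ⧸ level n K 𝔫)
    (hωs : ContDiffOn ℝ ((⊤ : ℕ∞) : WithTop ℕ∞)
      (fun H => @id (ResGLnCone.hermSpace n K [⋀^Fin (q + 1)]→L[ℝ] CoeffModule ℂ n K lam) (ConeDictionary.coneForm π.1 S lam η cL.out H)) (ResGLnCone.posCone n K))
    (Γc : Subgroup (glTotPos n K)) (hΓc : ∀ γ : Γc, diagPos n K (γ : glTotPos n K) • cL = cL)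
    (b : (Fin (q + 1) → Γc) → CoeffModule ℂ n K lam)
    (hbδ : ∀ P : Fin (q + 2) → Γc,
      Literature.Analysis.Calculus.conePeriod (q + 1) (fun H => ConeDictionary.coneForm π.1 S lam η cL.out H)
          (fun i => ResGLnCone.coneActionRat n K (((P i : glTotPos n K) : GL (Fin n) K)) (ResGLnCone.hermOne n K)) =
        ∑ i : Fin (q + 2), ((-1 : ℂ) ^ (i : ℕ)) • b (fun j => P (i.succAbove j)))
    (κ : (j : ℕ) → TwistedQuotient.Coch Γc (⊤ : Subgroup Γc) (ResGLnCone.hermSpace n K) (CoeffModule ℂ n K lam) j)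
    (hκlt : ∀ j, j < q → κ j = TwistedQuotient.stair (⊤ : Subgroup Γc)
        (((ResGLnCone.coneActionRat n K).comp (glTotPos n K).subtype).comp Γc.subtype)
        (TwistedQuotient.single (⊤ : Subgroup Γc) (fun (_ : Γc ⧸ (⊤ : Subgroup Γc)) (H : ResGLnCone.hermSpace n K) =>
          @id (ResGLnCone.hermSpace n K [⋀^Fin (q + 1)]→L[ℝ] CoeffModule ℂ n K lam) (ConeDictionary.coneForm π.1 S lam η cL.out H)))
        (ResGLnCone.hermOne n K) j)
    (hκq0 : ∀ (g : Fin (q + 1) → Γc) (c : Γc ⧸ (⊤ : Subgroup Γc)) (x : ResGLnCone.hermSpace n K),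
      κ q g c 0 x = TwistedQuotient.stair (⊤ : Subgroup Γc)
        (((ResGLnCone.coneActionRat n K).comp (glTotPos n K).subtype).comp Γc.subtype)
        (TwistedQuotient.single (⊤ : Subgroup Γc) (fun (_ : Γc ⧸ (⊤ : Subgroup Γc)) (H : ResGLnCone.hermSpace n K) =>
          @id (ResGLnCone.hermSpace n K [⋀^Fin (q + 1)]→L[ℝ] CoeffModule ℂ n K lam) (ConeDictionary.coneForm π.1 S lam η cL.out H)))
        (ResGLnCone.hermOne n K) q g c 0 x -
        ContinuousAlternatingMap.constOfIsEmpty ℝ (ResGLnCone.hermSpace n K) (Fin 0)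
          ((((-1 : ℝ) ^ ((q + 1) * (q + 2) / 2)) : ℂ) • b g))
    (hκqs : ∀ (g : Fin (q + 1) → Γc) (c : Γc ⧸ (⊤ : Subgroup Γc)) (r : ℕ) (x : ResGLnCone.hermSpace n K),
      κ q g c (r + 1) x = TwistedQuotient.stair (⊤ : Subgroup Γc)
        (((ResGLnCone.coneActionRat n K).comp (glTotPos n K).subtype).comp Γc.subtype)
        (TwistedQuotient.single (⊤ : Subgroup Γc) (fun (_ : Γc ⧸ (⊤ : Subgroup Γc)) (H : ResGLnCone.hermSpace n K) =>
          @id (ResGLnCone.hermSpace n K [⋀^Fin (q + 1)]→L[ℝ] CoeffModule ℂ n K lam) (ConeDictionary.coneForm π.1 S lam η cL.out H)))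
        (ResGLnCone.hermOne n K) q g c (r + 1) x) :
    (∀ j ≤ q, ∀ (g : Fin (j + 2) → Γc) (c : Γc ⧸ (⊤ : Subgroup Γc)), ∀ x ∈ ResGLnCone.posCone n K,
      TwistedQuotient.delta (⊤ : Subgroup Γc) (κ j) g c 0 x = 0) ∧
    (∀ (g : Fin (q + 2) → Γc) (c : Γc ⧸ (⊤ : Subgroup Γc)) (r : ℕ), ∀ x ∈ ResGLnCone.posCone n K,
      TwistedQuotient.delta (⊤ : Subgroup Γc) (κ q) g c r x = 0) ∧
    ∀ (g : Fin 1 → Γc) (c : Γc ⧸ (⊤ : Subgroup Γc)), ∀ x ∈ ResGLnCone.posCone n K,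
      TwistedQuotient.cochD (⊤ : Subgroup Γc) (κ 0) g c (q + 1) x =
        @id (ResGLnCone.hermSpace n K [⋀^Fin (q + 1)]→L[ℝ] CoeffModule ℂ n K lam) (ConeDictionary.coneForm π.1 S lam η cL.out x) := by
  have _keep := hΓc
  exact FamStairAlg.main2 (⊤ : Subgroup Γc)
    (((ResGLnCone.coneActionRat n K).comp (glTotPos n K).subtype).comp Γc.subtype)
    hω.isOpen hω.convex (fun γ => hω.mapsTo (γ : glTotPos n K)) (ResGLnCone.hermOne_mem_posCone n K)
    (fun (_ : Γc) (H : ResGLnCone.hermSpace n K) =>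
      @id (ResGLnCone.hermSpace n K [⋀^Fin (q + 1)]→L[ℝ] CoeffModule ℂ n K lam)
        (ConeDictionary.coneForm π.1 S lam η cL.out H))
    (fun _ => hωs) (fun _ x hx => hω.extDeriv_eq_zero cL.out x hx) b (fun g _ => hbδ g) κ hκlt hκq0 hκqs
end Summit.Langlands.Langlands.Theorems.HeckeEigenvalueField.Res

end
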